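/-
Copyright (c) 2026. All rights reserved.
Released under Apache 2.0 license as described in the file LICENSE.
Authors: HodgeCM publication cell (pub-hodgecm), GR lane, seat GR-1 (`pub-hodgecm-own-real34`).
-/
import Literature.NumberTheory.GelbartRogawski1991.DoubledWeilRepresentationArchLiftReps
import HarnessLib

/-!
# The doubled Weil representation, archimedean half (II″): the free signs at the real places of `E`

Topic `NumberTheory/GelbartRogawski1991`; namespace `Literature.NumberTheory.GelbartRogawski1991.GRConstructionGen`.
KERNEL only: proved theorems; no definition, no named fact, no `sorry`.  Sequel of
`DoubledWeilRepresentationArchLiftReps` (`isArchHalf_twist_archLift_of_reps`: the archimedean lift `sa ⊗ η` is an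
archimedean half once `η` satisfies the squares condition `hηS` and the Siegel-parabolic prescription holds on a
generating set `Q` of representatives of `P_Δ(F ⊗ ℝ)` modulo squares).

At a real place `v` of `F` split in `E` (places `w, w'` of `E` over `v`; `U(J^𝔻)(F_v) ≅ GL_{n+n}(ℝ) ∋ g_w`) the classes
of `P_Δ(F_v) ≅ P_{n,n}(ℝ)` modulo squares are `{±1}²` = (sign of `det` on `Δ_w`, sign of `det` on `Δ_{w'}`), and there
are two kinds of generators: the PAIR element `q₀` (`−` on both; `g_w = diag(ε, ε)`, `det g_w = +1`), on which the
prescription is a COMPUTATION (the framed section there is a conjugated orthogonal Levi element with origin value `1`,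
`Weil1964.MpS.conj_leviGL_apply_zero_of_orthogonal`, and `χ_w(-1)χ_{w'}(-1) = ε_{E/F,v}(-1) = 1`), and the SINGLE element
`q₁` (`−` on one side; `det g_w = −1`), on which the origin value `κ` of the candidate is only known up to sign
(`κ² = τ²`).  The sign character `s_v = sgn ∘ det ∘ (g ↦ g_w)` of `H(F ⊗ ℝ)` is `−1` on `q₁`, `+1` on the pair
elements and on the generators at the other places, and `s_v² = 1`; twisting `η` by `s_v` flips `κ(q₁)` and nothing
else.  Hence (**`exists_isArchHalf_twist_prod_signs`**): given `η₀` with `hηS`, the prescription on a set `Q₀` (the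
pair elements and whatever else is computable), single elements `q₁ i` and sign characters `s i` as above, THERE ARE
EXPONENTS `e i ∈ {0, 1}` such that `sa ⊗ (η₀ · ∏ᵢ sᵢ^{eᵢ})` is an archimedean half `IsArchHalf χ`.  No value at a
single element is ever computed — this is the existence half of [Kudla1994, §3, case `E_v = F_v ⊕ F_v`] (the
`det^{1/2}` cover of `GL_n(ℝ)` does not split, [Adams2007, §5 Rem. 5.6]; the character of record absorbs a sign).

* §1 `opD_conj_twist_mul_apply_zero` — twisting by a further character `η'` multiplies the origin value of
  `r_δ (sa ⊗ η)(q) r_δ⁻¹` by `η'(q)` (plus private bookkeeping: `(∏ᵢ sᵢ(g)^{eᵢ})² = 1`, values of the sign product);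
* §2 `isArchHalf_twist_prod_signs` (given exponents), **`exists_isArchHalf_twist_prod_signs`**.

([GelbartRogawski1991, §3.1 Prop. 3.1.1 p. 455]; [Kudla1994, §3]; [HarrisKudlaSweet1996, §1].)  Written for the
stage-1 cell `pub-hodgecm` (GR lane, seat GR-1); nothing here is a claim of the manuscripts adjudicated by that cell.

## References

* S. Gelbart, J. Rogawski, Invent. Math. 105 (1991), §3.1 Prop. 3.1.1 p. 455 [GelbartRogawski1991].
* S. S. Kudla, Israel J. Math. 87 (1994), §3 [Kudla1994].
* M. Harris, S. S. Kudla, W. J. Sweet, J. AMS 9 (1996), §1 [HarrisKudlaSweet1996].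
* J. Adams, *The theta correspondence over ℝ* (2007), §5 Rem. 5.6 [Adams2007].
-/

set_option autoImplicit false

noncomputable section

open scoped Classical
open scoped Matrix Kronecker TensorProduct
open NumberField IsDedekindDomain
open Literature.RepresentationTheory.HeisenbergGroup
open Literature.NumberTheory.Automorphic
open Literature.NumberTheory.Weil1964
open Literature.NumberTheory.GaloisRepresentations
open Literature.Analysis.SegalBargmann

namespace Literature.NumberTheory.GelbartRogawski1991.GRConstructionGen

open UnitaryDualPair

variable (F : Type) [Field F] [NumberField F] (E : Type) [Field E] [NumberField E] [Algebra F E]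
  [Algebra.IsQuadraticExtension F E]
variable (c : E ≃ₐ[F] E) {δ : E} (hcδ : c δ = -δ) (hδ : δ ≠ 0) {d : F} (hd : δ * δ = algebraMap F E d)
variable {N M n : ℕ} (e : Fin N × Fin M ≃ Fin n)
  (TV : Matrix (Fin N) (Fin N) F) (hV : TV.IsSymm) (hVd : IsUnit TV.det)
  (TW : Matrix (Fin M) (Fin M) F) (hW : TW.IsSymm) (hWd : IsUnit TW.det)

variable (jA : UnitaryGroup.arch F E c (n + n) (hermD F E e TV TW) →* HA F E c e TV TW)
  (hjA : jA = UnitaryGroup.archToAdelic F E c (n + n) (hermD F E e TV TW))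

variable {σ : Type*} [Fintype σ] [DecidableEq σ]
  (eW : (Fin (n + n) → mixedEmbedding.mixedSpace F) ≃L[ℝ] (σ → ℝ))
  (sW : UnitaryGroup.arch F E c (n + n) (hermD F E e TV TW) →* MpS σ)
  (hfin : ∀ (g : UnitaryGroup.arch F E c (n + n) (hermD F E e TV TW)) (k k' : Fin (n + n) → FiniteAdeleRing (𝓞 F) F),
    (((toSpD F E c hcδ hδ hd e TV hV TW hW).comp jA) g).1 (finVec k, finVec k') = (finVec k, finVec k'))
  (hdict : ∀ g : UnitaryGroup.arch F E c (n + n) (hermD F E e TV TW),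
    archPhaseMap (gramDA F e TV TW) eW (isUnit_archMat_gramDA F e TV hVd TW hWd) (((toSpD F E c hcδ hδ hd e TV hV TW hW).comp jA) g) =
      ⇑((MpS.proj (sW g)).1 : ((σ → ℝ) × (σ → ℝ)) ≃ₗ[ℝ] ((σ → ℝ) × (σ → ℝ))))
  (sa : UnitaryGroup.arch F E c (n + n) (hermD F E e TV TW) →* MpD F e TV TW)
  (hsa : sa = archLift (gramDA F e TV TW) eW (isUnit_archMat_gramDA F e TV hVd TW hWd)
        ((toSpD F E c hcδ hδ hd e TV hV TW hW).comp jA) sW hfin hdict)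
  (sgnA : UnitaryGroup.arch F E c (n + n) (hermD F E e TV TW) → ℝ)
  (hdiagS : ∀ g : UnitaryGroup.arch F E c (n + n) (hermD F E e TV TW), IsSiegelDelta F E c e TV TW (jA g) →
    ∃ A : ((Fin n → mixedEmbedding.mixedSpace F) × (Fin n → mixedEmbedding.mixedSpace F)) ≃ₗ[ℝ]
        ((Fin n → mixedEmbedding.mixedSpace F) × (Fin n → mixedEmbedding.mixedSpace F)),
      (∀ az : (Fin n → mixedEmbedding.mixedSpace F) × (Fin n → mixedEmbedding.mixedSpace F),
        archAct (gramDA F e TV TW) (((toSpD F E c hcδ hδ hd e TV hV TW hW).comp jA) g)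
            (Sum.elim az.1 az.1 ∘ ⇑(e₂ (n := n)).symm, Sum.elim az.2 az.2 ∘ ⇑(e₂ (n := n)).symm) =
          (Sum.elim (A az).1 (A az).1 ∘ ⇑(e₂ (n := n)).symm, Sum.elim (A az).2 (A az).2 ∘ ⇑(e₂ (n := n)).symm)) ∧
      ((LinearMap.det (A : ((Fin n → mixedEmbedding.mixedSpace F) × (Fin n → mixedEmbedding.mixedSpace F)) →ₗ[ℝ]
          ((Fin n → mixedEmbedding.mixedSpace F) × (Fin n → mixedEmbedding.mixedSpace F))) : ℝ) : ℂ) =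
        (sgnA g : ℂ) * ((modDelta F E c e TV TW (jA g) : ℝ) : ℂ) ^ 2)

/-! ## §1 Twisting by a further character; squares of sign products -/

section Twist

omit [NumberField E] [Algebra.IsQuadraticExtension F E] in
set_option maxHeartbeats 1600000 in
-- (instance unification on `𝓢`/`Mp(𝕎^𝔻)ᶜᵒⁿᵗ` operators is expensive)
/-- **twisting by a further character `η'` multiplies the origin value of `r_δ (sa ⊗ η)(q) r_δ⁻¹` by `η'(q)`**
(`(sa ⊗ ηη')(q) = (1, η'(q)) · (sa ⊗ η)(q)`, scalars are central). [cite: GelbartRogawski1991, §3.1 Prop. 3.1.1 p. 455] -/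
theorem opD_conj_twist_mul_apply_zero (η η' : UnitaryGroup.arch F E c (n + n) (hermD F E e TV TW) →* ℂˣ)
    (q : UnitaryGroup.arch F E c (n + n) (hermD F E e TV TW)) (Φ : piSchwartzBruhat F (Fin (n + n))) :
    opD F e TV TW (rDelta F e TV hVd TW hWd * adelicMpCont.twist F (Fin (n + n)) (gramDA F e TV TW) sa (η * η') q * (rDelta F e TV hVd TW hWd)⁻¹) Φ 0 =
      ((η' q : ℂˣ) : ℂ) *
        opD F e TV TW (rDelta F e TV hVd TW hWd * adelicMpCont.twist F (Fin (n + n)) (gramDA F e TV TW) sa η q * (rDelta F e TV hVd TW hWd)⁻¹) Φ 0 := by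
  -- `r_δ (sa ⊗ θ)(q) r_δ⁻¹ = (1, θ q) · (r_δ sa(q) r_δ⁻¹)` for `θ = η η'` and `θ = η`
  have key : ∀ θ : UnitaryGroup.arch F E c (n + n) (hermD F E e TV TW) →* ℂˣ,
      opD F e TV TW (rDelta F e TV hVd TW hWd * adelicMpCont.twist F (Fin (n + n)) (gramDA F e TV TW) sa θ q * (rDelta F e TV hVd TW hWd)⁻¹) Φ 0 =
        ((θ q : ℂˣ) : ℂ) * opD F e TV TW (rDelta F e TV hVd TW hWd * sa q * (rDelta F e TV hVd TW hWd)⁻¹) Φ 0 := by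
    intro θ
    rw [conj_twist_eq, opD_mul]
    simp only [opD, adelicMpCont.omega_ofScalar, Submodule.coe_smul, Pi.smul_apply, smul_eq_mul]
  have hmul : (((η * η') q : ℂˣ) : ℂ) = ((η q : ℂˣ) : ℂ) * ((η' q : ℂˣ) : ℂ) := by
    rw [MonoidHom.mul_apply, Units.val_mul]
  conv_lhs => rw [key (η * η'), hmul]
  conv_rhs => rw [key η]
  ring

omit [NumberField F] [NumberField E] [Algebra.IsQuadraticExtension F E] in
/-- the value of a product of powers of characters. [folklore] -/
private theorem coe_prod_pow_apply {ι₁ : Type*} [Fintype ι₁] (s : ι₁ → (UnitaryGroup.arch F E c (n + n) (hermD F E e TV TW) →* ℂˣ))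
    (ex : ι₁ → ℕ) (g : UnitaryGroup.arch F E c (n + n) (hermD F E e TV TW)) :
    (((∏ i, s i ^ ex i) g : ℂˣ) : ℂ) = ∏ i, ((s i g : ℂˣ) : ℂ) ^ ex i := by
  rw [MonoidHom.finsetProd_apply, Units.coe_prod]
  refine Finset.prod_congr rfl fun i _ => ?_
  rw [MonoidHom.pow_apply, Units.val_pow_eq_pow_val]

omit [NumberField F] [NumberField E] [Algebra.IsQuadraticExtension F E] in
/-- `(∏ᵢ sᵢ(g)^{eᵢ})² = 1` for sign characters `sᵢ² = 1`. [folklore] -/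
private theorem sq_coe_prod_pow_apply {ι₁ : Type*} [Fintype ι₁] (s : ι₁ → (UnitaryGroup.arch F E c (n + n) (hermD F E e TV TW) →* ℂˣ))
    (hs2 : ∀ i g, s i g * s i g = 1) (ex : ι₁ → ℕ) (g : UnitaryGroup.arch F E c (n + n) (hermD F E e TV TW)) :
    (((∏ i, s i ^ ex i) g : ℂˣ) : ℂ) ^ 2 = 1 := by
  rw [coe_prod_pow_apply, ← Finset.prod_pow]
  refine Finset.prod_eq_one fun i _ => ?_
  rw [← pow_mul, mul_comm, pow_mul, ← Units.val_pow_eq_pow_val, ← Units.val_pow_eq_pow_val, sq, hs2 i g, one_pow,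
    Units.val_one]

omit [NumberField F] [NumberField E] [Algebra.IsQuadraticExtension F E] in
/-- the value of the sign product at an element where all but one sign character are trivial. [folklore] -/
private theorem coe_prod_pow_apply_eq_pow {ι₁ : Type*} [Fintype ι₁] (s : ι₁ → (UnitaryGroup.arch F E c (n + n) (hermD F E e TV TW) →* ℂˣ))
    (ex : ι₁ → ℕ) (g : UnitaryGroup.arch F E c (n + n) (hermD F E e TV TW)) (j : ι₁) (hj : ∀ i, i ≠ j → s i g = 1) :
    (((∏ i, s i ^ ex i) g : ℂˣ) : ℂ) = ((s j g : ℂˣ) : ℂ) ^ ex j := by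
  rw [coe_prod_pow_apply, Finset.prod_eq_single j (fun i _ hij => by rw [hj i hij, Units.val_one, one_pow])
    (fun h => absurd (Finset.mem_univ j) h)]

omit [NumberField F] [NumberField E] [Algebra.IsQuadraticExtension F E] in
/-- the value of the sign product at an element where all sign characters are trivial is `1`. [folklore] -/
private theorem coe_prod_pow_apply_eq_one {ι₁ : Type*} [Fintype ι₁] (s : ι₁ → (UnitaryGroup.arch F E c (n + n) (hermD F E e TV TW) →* ℂˣ))
    (ex : ι₁ → ℕ) (g : UnitaryGroup.arch F E c (n + n) (hermD F E e TV TW)) (hg : ∀ i, s i g = 1) :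
    (((∏ i, s i ^ ex i) g : ℂˣ) : ℂ) = 1 := by
  rw [coe_prod_pow_apply]
  exact Finset.prod_eq_one fun i _ => by rw [hg i, Units.val_one, one_pow]

end Twist

/-! ## §2 Existence of the sign exponents -/

section Signs

include hsa hjA hdiagS in
set_option maxHeartbeats 3200000 in
-- (the assembly elaborates many `Mp(𝕎^𝔻)ᶜᵒⁿᵗ`/`𝓢` terms; instance unification is expensive)
/-- **the sign-twisted lift is an archimedean half, given exponents that fix the single elements**: with the data of
`exists_isArchHalf_twist_prod_signs` below and exponents `ex` such that at each single element `q₁ j` the origin value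
`κⱼ` of the `η₀`-candidate satisfies `sⱼ(q₁ j)^{eⱼ} · κⱼ = χ(det_Δ)|det_Δ|^{1/2}`, the twist `sa ⊗ (η₀ · ∏ᵢ sᵢ^{eᵢ})` is an
archimedean half. [cite: GelbartRogawski1991, §3.1 Prop. 3.1.1 p. 455] [cite: Kudla1994, §3] -/
theorem isArchHalf_twist_prod_signs (χ : HeckeCharacter E) (hcont : Continuous sa)
    (η₀ : UnitaryGroup.arch F E c (n + n) (hermD F E e TV TW) →* ℂˣ) (hη₀c : Continuous fun g => ((η₀ g : ℂˣ) : ℂ))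
    (hηS : ∀ g : UnitaryGroup.arch F E c (n + n) (hermD F E e TV TW), IsSiegelDelta F E c e TV TW (jA g) →
      ((η₀ g : ℂˣ) : ℂ) ^ 2 * MpS.quot (sW g) * (sgnA g : ℂ) = ((chiDet F E c e TV TW χ (jA g) : ℂˣ) : ℂ) ^ 2)
    {ι₁ : Type*} [Fintype ι₁]
    (s : ι₁ → (UnitaryGroup.arch F E c (n + n) (hermD F E e TV TW) →* ℂˣ)) (hs2 : ∀ i g, s i g * s i g = 1)
    (hsc : ∀ i, Continuous fun g => ((s i g : ℂˣ) : ℂ))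
    (Q₀ : Set (UnitaryGroup.arch F E c (n + n) (hermD F E e TV TW)))
    (hQ₀ : ∀ q ∈ Q₀, IsSiegelDelta F E c e TV TW (jA q))
    (q₁ : ι₁ → UnitaryGroup.arch F E c (n + n) (hermD F E e TV TW)) (hq₁ : ∀ i, IsSiegelDelta F E c e TV TW (jA (q₁ i)))
    (hs₀ : ∀ i, ∀ q ∈ Q₀, s i q = 1) (hs₁ : ∀ i j, i ≠ j → s i (q₁ j) = 1)
    (hgen : ∀ p : UnitaryGroup.arch F E c (n + n) (hermD F E e TV TW), IsSiegelDelta F E c e TV TW (jA p) →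
      ∃ (l m : List (UnitaryGroup.arch F E c (n + n) (hermD F E e TV TW))),
        (∀ q' ∈ l, IsSiegelDelta F E c e TV TW (jA q')) ∧ (∀ q ∈ m, q ∈ Q₀ ∨ q ∈ Set.range q₁) ∧
          p = (l.map fun q' => q' * q').prod * m.prod)
    (hval₀ : ∀ q ∈ Q₀, ∀ Φ : piSchwartzBruhat F (Fin (n + n)),
      opD F e TV TW (rDelta F e TV hVd TW hWd * adelicMpCont.twist F (Fin (n + n)) (gramDA F e TV TW) sa η₀ q * (rDelta F e TV hVd TW hWd)⁻¹) Φ 0 =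
        ((chiDet F E c e TV TW χ (jA q) : ℂˣ) : ℂ) * (modDelta F E c e TV TW (jA q) : ℂ) *
          (Φ : (Fin (n + n) → AdeleRing (𝓞 F) F) → ℂ) 0)
    (ex : ι₁ → ℕ)
    (hfix : ∀ j, ∃ κ : ℂ,
      (∀ Φ : piSchwartzBruhat F (Fin (n + n)),
        opD F e TV TW (rDelta F e TV hVd TW hWd * adelicMpCont.twist F (Fin (n + n)) (gramDA F e TV TW) sa η₀ (q₁ j) * (rDelta F e TV hVd TW hWd)⁻¹) Φ 0 =
          κ * (Φ : (Fin (n + n) → AdeleRing (𝓞 F) F) → ℂ) 0) ∧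
      ((s j (q₁ j) : ℂˣ) : ℂ) ^ ex j * κ =
        ((chiDet F E c e TV TW χ (jA (q₁ j)) : ℂˣ) : ℂ) * (modDelta F E c e TV TW (jA (q₁ j)) : ℂ)) :
    IsArchHalf F E c hcδ hδ hd e TV hV hVd TW hW hWd χ
      (adelicMpCont.twist F (Fin (n + n)) (gramDA F e TV TW) sa (η₀ * ∏ i, s i ^ ex i)) := by
  have hηc : Continuous fun g => (((η₀ * ∏ i, s i ^ ex i) g : ℂˣ) : ℂ) := by
    have h : (fun g => (((η₀ * ∏ i, s i ^ ex i) g : ℂˣ) : ℂ)) = fun g => ((η₀ g : ℂˣ) : ℂ) * ∏ i, ((s i g : ℂˣ) : ℂ) ^ ex i := by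
      funext g; rw [MonoidHom.mul_apply, Units.val_mul, coe_prod_pow_apply]
    rw [h]
    exact hη₀c.mul (continuous_finsetProd _ fun i _ => (hsc i).pow _)
  have hηS' : ∀ g : UnitaryGroup.arch F E c (n + n) (hermD F E e TV TW), IsSiegelDelta F E c e TV TW (jA g) →
      (((η₀ * ∏ i, s i ^ ex i) g : ℂˣ) : ℂ) ^ 2 * MpS.quot (sW g) * (sgnA g : ℂ) = ((chiDet F E c e TV TW χ (jA g) : ℂˣ) : ℂ) ^ 2 := by
    intro g hg
    rw [MonoidHom.mul_apply, Units.val_mul, mul_pow, sq_coe_prod_pow_apply F E c e TV TW s hs2 ex g, mul_one]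
    exact hηS g hg
  have hQ : ∀ q ∈ Q₀ ∪ Set.range q₁, IsSiegelDelta F E c e TV TW (jA q) := by
    rintro q (hq | ⟨i, rfl⟩)
    · exact hQ₀ q hq
    · exact hq₁ i
  have hgen' : ∀ p : UnitaryGroup.arch F E c (n + n) (hermD F E e TV TW), IsSiegelDelta F E c e TV TW (jA p) →
      ∃ (l m : List (UnitaryGroup.arch F E c (n + n) (hermD F E e TV TW))),
        (∀ q' ∈ l, IsSiegelDelta F E c e TV TW (jA q')) ∧ (∀ q ∈ m, q ∈ Q₀ ∪ Set.range q₁) ∧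
          p = (l.map fun q' => q' * q').prod * m.prod := by
    intro p hp
    obtain ⟨l, m, hl, hm, hp⟩ := hgen p hp
    exact ⟨l, m, hl, fun q hq => (hm q hq).elim (fun h => Or.inl h) (fun h => Or.inr h), hp⟩
  have hval : ∀ q ∈ Q₀ ∪ Set.range q₁, ∀ Φ : piSchwartzBruhat F (Fin (n + n)),
      opD F e TV TW (rDelta F e TV hVd TW hWd * adelicMpCont.twist F (Fin (n + n)) (gramDA F e TV TW) sa (η₀ * ∏ i, s i ^ ex i) q * (rDelta F e TV hVd TW hWd)⁻¹) Φ 0 =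
        ((chiDet F E c e TV TW χ (jA q) : ℂˣ) : ℂ) * (modDelta F E c e TV TW (jA q) : ℂ) *
          (Φ : (Fin (n + n) → AdeleRing (𝓞 F) F) → ℂ) 0 := by
    rintro q (hq | ⟨j, rfl⟩) Φ
    · -- on `Q₀` the sign twist is trivial
      rw [opD_conj_twist_mul_apply_zero, coe_prod_pow_apply_eq_one F E c e TV TW s ex q (fun i => hs₀ i q hq), one_mul]
      exact hval₀ q hq Φ
    · -- at `q₁ j` the sign twist is `sⱼ(q₁ j)^{eⱼ}` and fixes the sign of `κⱼ`
      obtain ⟨κ, hκ, hκfix⟩ := hfix j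
      rw [opD_conj_twist_mul_apply_zero, coe_prod_pow_apply_eq_pow F E c e TV TW s ex (q₁ j) j (fun i hij => hs₁ i j hij),
        hκ Φ, ← mul_assoc, hκfix]
  exact isArchHalf_twist_archLift_of_reps F E c hcδ hδ hd e TV hV hVd TW hW hWd jA hjA eW sW hfin hdict sa hsa sgnA hdiagS χ hcont
    (η₀ * ∏ i, s i ^ ex i) hηc hηS' (Q₀ ∪ Set.range q₁) hQ hgen' hval

include hsa hjA hdiagS in
set_option maxHeartbeats 3200000 in
-- (the assembly elaborates many `Mp(𝕎^𝔻)ᶜᵒⁿᵗ`/`𝓢` terms; instance unification is expensive)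
/-- **THE FREE SIGNS AT THE REAL PLACES OF `E`.**  Let `η₀` be a continuous character of `H(F ⊗ ℝ)` with the squares
condition `hηS`; let `Q₀ ⊆ P_Δ(F ⊗ ℝ)` be representatives on which the prescription HOLDS for `sa ⊗ η₀` (`hval₀`; the pair
elements), `q₁ i ∈ P_Δ(F ⊗ ℝ)` (`i ∈ ι₁`, the single elements) further representatives, such that `Q₀ ∪ {q₁ i}` generates
`P_Δ(F ⊗ ℝ)` modulo squares (`hgen`); and let `s i` be continuous characters with `sᵢ² = 1`, `sᵢ = 1` on `Q₀` and on
`q₁ j` (`j ≠ i`), `sᵢ(q₁ i) = −1`.  Then for suitable exponents `e i ∈ {0, 1}` the twist `sa ⊗ (η₀ · ∏ᵢ sᵢ^{eᵢ})` is an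
archimedean half of the doubled Weil representation: `IsArchHalf χ`.  (At `q₁ i` the origin value `κᵢ` of the
`η₀`-candidate has `κᵢ² = τᵢ²` by `exists_originValue_sq_signed`; take `eᵢ = 0` if `κᵢ = τᵢ`, `eᵢ = 1` if `κᵢ = −τᵢ`.)
[cite: GelbartRogawski1991, §3.1 Prop. 3.1.1 p. 455] [cite: Kudla1994, §3] -/
theorem exists_isArchHalf_twist_prod_signs (χ : HeckeCharacter E) (hcont : Continuous sa)
    (η₀ : UnitaryGroup.arch F E c (n + n) (hermD F E e TV TW) →* ℂˣ) (hη₀c : Continuous fun g => ((η₀ g : ℂˣ) : ℂ))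
    (hηS : ∀ g : UnitaryGroup.arch F E c (n + n) (hermD F E e TV TW), IsSiegelDelta F E c e TV TW (jA g) →
      ((η₀ g : ℂˣ) : ℂ) ^ 2 * MpS.quot (sW g) * (sgnA g : ℂ) = ((chiDet F E c e TV TW χ (jA g) : ℂˣ) : ℂ) ^ 2)
    {ι₁ : Type*} [Fintype ι₁]
    (s : ι₁ → (UnitaryGroup.arch F E c (n + n) (hermD F E e TV TW) →* ℂˣ)) (hs2 : ∀ i g, s i g * s i g = 1)
    (hsc : ∀ i, Continuous fun g => ((s i g : ℂˣ) : ℂ))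
    (Q₀ : Set (UnitaryGroup.arch F E c (n + n) (hermD F E e TV TW)))
    (hQ₀ : ∀ q ∈ Q₀, IsSiegelDelta F E c e TV TW (jA q))
    (q₁ : ι₁ → UnitaryGroup.arch F E c (n + n) (hermD F E e TV TW)) (hq₁ : ∀ i, IsSiegelDelta F E c e TV TW (jA (q₁ i)))
    (hs₀ : ∀ i, ∀ q ∈ Q₀, s i q = 1) (hs₁ : ∀ i j, i ≠ j → s i (q₁ j) = 1) (hs₁' : ∀ i, ((s i (q₁ i) : ℂˣ) : ℂ) = -1)
    (hgen : ∀ p : UnitaryGroup.arch F E c (n + n) (hermD F E e TV TW), IsSiegelDelta F E c e TV TW (jA p) →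
      ∃ (l m : List (UnitaryGroup.arch F E c (n + n) (hermD F E e TV TW))),
        (∀ q' ∈ l, IsSiegelDelta F E c e TV TW (jA q')) ∧ (∀ q ∈ m, q ∈ Q₀ ∨ q ∈ Set.range q₁) ∧
          p = (l.map fun q' => q' * q').prod * m.prod)
    (hval₀ : ∀ q ∈ Q₀, ∀ Φ : piSchwartzBruhat F (Fin (n + n)),
      opD F e TV TW (rDelta F e TV hVd TW hWd * adelicMpCont.twist F (Fin (n + n)) (gramDA F e TV TW) sa η₀ q * (rDelta F e TV hVd TW hWd)⁻¹) Φ 0 =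
        ((chiDet F E c e TV TW χ (jA q) : ℂˣ) : ℂ) * (modDelta F E c e TV TW (jA q) : ℂ) *
          (Φ : (Fin (n + n) → AdeleRing (𝓞 F) F) → ℂ) 0) :
    ∃ ex : ι₁ → ℕ, (∀ i, ex i = 0 ∨ ex i = 1) ∧
      IsArchHalf F E c hcδ hδ hd e TV hV hVd TW hW hWd χ
        (adelicMpCont.twist F (Fin (n + n)) (gramDA F e TV TW) sa (η₀ * ∏ i, s i ^ ex i)) := by
  -- (1) the origin values `κ i` of the `η₀`-candidate at the single elements, `κ i ^ 2 = τ i ^ 2`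
  obtain ⟨A, P, hr⟩ := exists_omega_tmul (gramDA F e TV TW)
    (mulVec_surjective_of_isUnit_det F (gramDA F e TV TW) (isUnit_det_gramDA F e TV hVd TW hWd)) (rDelta F e TV hVd TW hWd)
  obtain ⟨z, hz⟩ := exists_MpS_over_archPhaseMap (gramDA F e TV TW) eW (isUnit_archMat_gramDA F e TV hVd TW hWd)
    (ratSp F (gramDA F e TV TW) (isUnit_det_gramDA F e TV hVd TW hWd) (deltaD F))
  have hπr : adelicMpCont.proj F (Fin (n + n)) (gramDA F e TV TW) (rDelta F e TV hVd TW hWd) =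
      ratSp F (gramDA F e TV TW) (isUnit_det_gramDA F e TV hVd TW hWd) (deltaD F) :=
    projD_rDelta F e TV hVd TW hWd
  have hz' : (⇑((MpS.proj z).1 : ((σ → ℝ) × (σ → ℝ)) ≃ₗ[ℝ] ((σ → ℝ) × (σ → ℝ))) : ((σ → ℝ) × (σ → ℝ)) → ((σ → ℝ) × (σ → ℝ))) =
      archPhaseMap (gramDA F e TV TW) eW (isUnit_archMat_gramDA F e TV hVd TW hWd) (adelicMpCont.proj F (Fin (n + n)) (gramDA F e TV TW) (rDelta F e TV hVd TW hWd)) := by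
    rw [hπr]; exact hz
  have horig : ∀ i, ∃ κ : ℂ, (∀ Φ, opD F e TV TW (rDelta F e TV hVd TW hWd * adelicMpCont.twist F (Fin (n + n)) (gramDA F e TV TW) sa η₀ (q₁ i) * (rDelta F e TV hVd TW hWd)⁻¹) Φ 0 =
        κ * (Φ : (Fin (n + n) → AdeleRing (𝓞 F) F) → ℂ) 0) ∧
      κ ^ 2 = ((((chiDet F E c e TV TW χ (jA (q₁ i)) : ℂˣ) : ℂ) * (modDelta F E c e TV TW (jA (q₁ i)) : ℂ))) ^ 2 :=
    fun i => exists_originValue_sq_signed F E c hcδ hδ hd e TV hV hVd TW hW hWd jA eW sW hfin hdict sa hsa sgnA hdiagS χ η₀ hηS A P hr z hz' (q₁ i) (hq₁ i)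
  choose κ hκ using horig
  -- (2) the exponents: `0` where `κ i = τ i`, `1` where `κ i = -τ i`
  refine ⟨fun i => if κ i = (((chiDet F E c e TV TW χ (jA (q₁ i)) : ℂˣ) : ℂ) * (modDelta F E c e TV TW (jA (q₁ i)) : ℂ)) then 0 else 1,
    fun i => ?_, ?_⟩
  · by_cases h : κ i = (((chiDet F E c e TV TW χ (jA (q₁ i)) : ℂˣ) : ℂ) * (modDelta F E c e TV TW (jA (q₁ i)) : ℂ))
    · exact Or.inl (if_pos h)
    · exact Or.inr (if_neg h)
  · refine isArchHalf_twist_prod_signs F E c hcδ hδ hd e TV hV hVd TW hW hWd jA hjA eW sW hfin hdict sa hsa sgnA hdiagS χ hcont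
      η₀ hη₀c hηS s hs2 hsc Q₀ hQ₀ q₁ hq₁ hs₀ hs₁ hgen hval₀ _ fun j => ⟨κ j, (hκ j).1, ?_⟩
    by_cases h : κ j = (((chiDet F E c e TV TW χ (jA (q₁ j)) : ℂˣ) : ℂ) * (modDelta F E c e TV TW (jA (q₁ j)) : ℂ))
    · rw [if_pos h, pow_zero, one_mul, h]
    · have h' : κ j = -((((chiDet F E c e TV TW χ (jA (q₁ j)) : ℂˣ) : ℂ) * (modDelta F E c e TV TW (jA (q₁ j)) : ℂ))) := by
        rcases sq_eq_sq_iff_eq_or_eq_neg.1 (hκ j).2 with h1 | h1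
        · exact absurd h1 h
        · exact h1
      rw [if_neg h, pow_one, hs₁' j, h']
      ring

end Signs

end Literature.NumberTheory.GelbartRogawski1991.GRConstructionGen

end
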